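import Summits.Ventures.HodgeRepro2.T5InertCartanInvariant
import Summits.Ventures.HodgeRepro2.T5InertUnipotentResidue

/-!
# The unipotent radical at an inert place and its conjugates by the cells
(cell pub-hodge-repro2, seat p3)

Tier-5 N3 support, towards T5-SATAKE-KERNEL-p3.md row 12 (the normalisation of the Satake transform): the
transform integrates over the upper unipotent radical `N = {n(x, z)}` of `U(antidiag(1, u, 1))` against the
translates `a_m n`, `m ∈ ℤ`. This file supplies the objects:

* **`upperUnipotent u`** — `N` as a subgroup of `U(J₃(u))` (p8's `upper3`, file 195's `upper3_mul`, p8's `upper3_inv`),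
  `mem_upperUnipotent_iff`, `unipCong_le_upperUnipotent` (every congruence subgroup `N_{a,b}` of file 195 lies in `N`);
* **`cellZ m`** — the cell `a_m = diag(ϖ^m, 1, ϖ^{−m})` for `m ∈ ℤ` (`cellU m` for `m ≥ 0`, `(cellU (−m))⁻¹`
  for `m < 0`), `coe_cellZ`, `cellZ_natCast`, `cellZ_neg`, `cellZ_mul_upper3` (the matrix of `a_m n(x, z)`);
* `diag_mul_upper3_mul_diag_inv` — `diag(d, 1, d⁻¹) · n(x, z) · diag(d⁻¹, 1, d) = n(d x, d² z)` for `star d = d`;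
* **`cellZ_mul_upper3_mul_cellZ_inv`** — `a_m n(x, z) a_m⁻¹ = n(ϖ^m x, ϖ^{2m} z)`;
* **`map_conj_cellU_unipCong`** — `a_m N_{a,b} a_m⁻¹ = N_{a+m, b+2m}` (`m ∈ ℕ`), as an equality of subgroups.

Mathlib + this seat's files 209 / 196 and their imports; no display; no device.
§8(d): uses an L-value-free non-vanishing device: NO.
-/

namespace Summit.Ventures.HodgeRepro2.T5InertUnipotentRadical

open Matrix
open Summit.Ventures.HodgeRepro2.T5CartanCellsDistinct Summit.Ventures.HodgeRepro2.T5HeckeBasisCells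
  Summit.Ventures.HodgeRepro2.T5HermitianThreeElements Summit.Ventures.HodgeRepro2.T5UnitaryGroupForm
  Summit.Ventures.HodgeRepro2.T5UnitaryHeckeAdjoint Summit.Ventures.HodgeRepro2.T5InertUnipotentCongruence
  Summit.Ventures.HodgeRepro2.T5InertTopCoefficientMatrix Summit.Ventures.HodgeRepro2.T5InertTopCoefficient
  Summit.Ventures.HodgeRepro2.T5InertDegreePrinted

/-! ## The unipotent radical -/

section Radical

variable {E : Type*} [Field E] [StarRing E] (u : E)

/-- **The upper unipotent radical** `N = {n(x, z)}` of `U(J₃(u))`. -/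
def upperUnipotent : Subgroup (formUnitaryGroup (J3 u)) where
  carrier := {g | ∃ x z : E, (g : GL (Fin 3) E) = upper3 u x z}
  one_mem' := ⟨0, 0, by rw [OneMemClass.coe_one, upper3_zero_zero]⟩
  mul_mem' := by
    rintro g g' ⟨x, z, hg⟩ ⟨x', z', hg'⟩
    exact ⟨x + x', z + z' - x * star x' / u, by rw [Subgroup.coe_mul, hg, hg', upper3_mul]⟩
  inv_mem' := by
    rintro g ⟨x, z, hg⟩
    exact ⟨-x, x * (-star x / u) - z, by rw [Subgroup.coe_inv, hg, upper3_inv]⟩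

/-- Membership in `N`. -/
theorem mem_upperUnipotent_iff {g : formUnitaryGroup (J3 u)} :
    g ∈ upperUnipotent u ↔ ∃ x z : E, (g : GL (Fin 3) E) = upper3 u x z :=
  Iff.rfl

variable {R : Type*} [CommRing R] [Algebra R E] [IsFractionRing R E]
  (hstar : ∀ x : E, IsLocalization.IsInteger R x → IsLocalization.IsInteger R (star x))
  (hu' : IsLocalization.IsInteger R u⁻¹) {ϖ : R} (hs : star (algebraMap R E ϖ) = algebraMap R E ϖ)

omit [IsFractionRing R E] in
/-- Every congruence subgroup `N_{a,b}` lies in `N`. -/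
theorem unipCong_le_upperUnipotent {a b : ℕ} {hab : b ≤ 2 * a} :
    unipCong hstar u hu' hs a b hab ≤ upperUnipotent u := by
  rintro g ⟨x, z, hg⟩
  exact ⟨_, _, hg⟩

end Radical

/-! ## The cells `a_m`, `m ∈ ℤ` -/

section Cells

variable {R E : Type*} [CommRing R] [Field E] [StarRing E] [Algebra R E] [IsFractionRing R E]
  (u : E) {ϖ : R} (hϖ : Irreducible ϖ) (hs : star (algebraMap R E ϖ) = algebraMap R E ϖ)

/-- **The cell `a_m = diag(ϖ^m, 1, ϖ^{−m})` for `m ∈ ℤ`.** -/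
noncomputable def cellZ (m : ℤ) : formUnitaryGroup (J3 u) :=
  if 0 ≤ m then cellU hϖ hs u m.toNat else (cellU hϖ hs u (-m).toNat)⁻¹

/-- `a_m = cellU m` for `m ∈ ℕ`. -/
theorem cellZ_natCast (m : ℕ) : cellZ u hϖ hs (m : ℤ) = cellU hϖ hs u m := by
  simp only [cellZ, Int.natCast_nonneg, if_true, Int.toNat_natCast]

/-- `a_{−m} = a_m⁻¹`. -/
theorem cellZ_neg (m : ℤ) : cellZ u hϖ hs (-m) = (cellZ u hϖ hs m)⁻¹ := by
  rcases le_or_gt 0 m with hm | hm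
  · rcases hm.eq_or_lt with rfl | hm'
    · simp [cellZ, cellU_zero u hϖ hs]
    · simp only [cellZ, neg_nonneg, not_le.2 hm', if_false, neg_neg, hm, if_true]
  · simp only [cellZ, neg_nonneg, hm.le, if_true, not_le.2 hm, if_false, inv_inv]

/-- The matrix of `a_m`. -/
theorem coe_cellZ (m : ℤ) :
    (((cellZ u hϖ hs m : formUnitaryGroup (J3 u)) : GL (Fin 3) E) : Matrix (Fin 3) (Fin 3) E) =
      !![algebraMap R E ϖ ^ m, 0, 0; 0, 1, 0; 0, 0, algebraMap R E ϖ ^ (-m)] := by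
  rcases le_or_gt 0 m with hm | hm
  · obtain ⟨k, rfl⟩ := Int.eq_ofNat_of_zero_le hm
    rw [cellZ_natCast, coe_cellU, coe_cell]
  · obtain ⟨k, hk⟩ := Int.exists_eq_neg_ofNat hm.le
    subst hk
    rw [cellZ_neg, cellZ_natCast, Subgroup.coe_inv, coe_cellU, coe_cell_inv, neg_neg]
    ext i j
    fin_cases i <;> fin_cases j <;> simp [Matrix.diagonal]

end Cells

/-! ## Conjugating a unipotent element by a cell -/

section Conj

variable {E : Type*} [Field E] [StarRing E] (u : E)

/-- `diag(d, 1, d⁻¹) · n(x, z) · diag(d⁻¹, 1, d) = n(d x, d² z)` when `star d = d`. -/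
theorem diag_mul_upper3_mul_diag_inv {d : E} (hd0 : d ≠ 0) (hsd : star d = d) (x z : E) :
    !![d, 0, 0; 0, 1, 0; 0, 0, d⁻¹] * ((upper3 u x z : GL (Fin 3) E) : Matrix (Fin 3) (Fin 3) E) *
        !![d⁻¹, 0, 0; 0, 1, 0; 0, 0, d] =
      ((upper3 u (d * x) (d ^ 2 * z) : GL (Fin 3) E) : Matrix (Fin 3) (Fin 3) E) := by
  rw [coe_upper3, coe_upper3, Matrix.mul_fin_three, Matrix.mul_fin_three, fin_three_eq_iff]
  refine ⟨by field_simp; try ring, by ring, by ring, by ring, by ring, ?_, by ring, by ring,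
    by field_simp; try ring⟩
  rw [star_mul, hsd]
  ring

variable {R : Type*} [CommRing R] [Algebra R E] [IsFractionRing R E] {ϖ : R} (hϖ : Irreducible ϖ)
  (hs : star (algebraMap R E ϖ) = algebraMap R E ϖ)

omit [StarRing E] in
include hϖ in
/-- `ϖ^m ≠ 0` in `E`. -/
theorem zpow_uniformiser_ne_zero (m : ℤ) : algebraMap R E ϖ ^ m ≠ 0 :=
  zpow_ne_zero m ((map_ne_zero_iff _ (IsFractionRing.injective R E)).2 hϖ.ne_zero)

omit [IsFractionRing R E] in
include hs in
/-- `star (ϖ^m) = ϖ^m`. -/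
theorem star_zpow_uniformiser (m : ℤ) : star (algebraMap R E ϖ ^ m) = algebraMap R E ϖ ^ m := by
  rw [star_zpow₀, hs]

include hϖ in
/-- The matrix of `a_m · n(x, z)`. -/
theorem cellZ_mul_upper3 (m : ℤ) (x z : E) :
    (((cellZ u hϖ hs m : formUnitaryGroup (J3 u)) : GL (Fin 3) E) : Matrix (Fin 3) (Fin 3) E) *
        ((upper3 u x z : GL (Fin 3) E) : Matrix (Fin 3) (Fin 3) E) =
      !![algebraMap R E ϖ ^ m, algebraMap R E ϖ ^ m * x, algebraMap R E ϖ ^ m * z;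
        0, 1, -star x / u; 0, 0, algebraMap R E ϖ ^ (-m)] := by
  rw [coe_cellZ, coe_upper3, Matrix.mul_fin_three, fin_three_eq_iff]
  refine ⟨by ring, by ring, by ring, by ring, by ring, by ring, by ring, by ring, by ring⟩

include hϖ in
/-- **`a_m · n(x, z) · a_m⁻¹ = n(ϖ^m x, ϖ^{2m} z)`.** -/
theorem cellZ_mul_upper3_mul_cellZ_inv (m : ℤ) (x z : E) :
    ((cellZ u hϖ hs m : formUnitaryGroup (J3 u)) : GL (Fin 3) E) * upper3 u x z *
        (((cellZ u hϖ hs m : formUnitaryGroup (J3 u)) : GL (Fin 3) E))⁻¹ =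
      upper3 u (algebraMap R E ϖ ^ m * x) (algebraMap R E ϖ ^ (2 * m) * z) := by
  ext1
  rw [Units.val_mul, Units.val_mul, ← Subgroup.coe_inv, ← cellZ_neg, coe_cellZ, coe_cellZ, neg_neg]
  have h := diag_mul_upper3_mul_diag_inv u (zpow_uniformiser_ne_zero hϖ m) (star_zpow_uniformiser hs m) x z
  rw [← _root_.zpow_neg] at h
  rw [h]
  congr 2
  rw [← zpow_natCast, ← _root_.zpow_mul]
  congr 1
  push_cast
  ring

end Conj

/-! ## The conjugate of a congruence subgroup -/

section ConjCong

variable {R E : Type*} [CommRing R] [Field E] [StarRing E] [Algebra R E] [IsFractionRing R E]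
  (hstar : ∀ x : E, IsLocalization.IsInteger R x → IsLocalization.IsInteger R (star x))
  (u : E) (hu' : IsLocalization.IsInteger R u⁻¹) {ϖ : R} (hϖ : Irreducible ϖ)
  (hs : star (algebraMap R E ϖ) = algebraMap R E ϖ)

omit [StarRing E] [IsFractionRing R E] in
/-- The first coordinate after conjugation: `ϖ^m · (ϖ^a x) = ϖ^{a+m} x`. -/
theorem zpow_mul_pow_mul (m a : ℕ) (x : E) :
    algebraMap R E ϖ ^ (m : ℤ) * (algebraMap R E ϖ ^ a * x) = algebraMap R E ϖ ^ (a + m) * x := by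
  rw [zpow_natCast, pow_add]
  ring

omit [StarRing E] [IsFractionRing R E] in
/-- The second coordinate after conjugation: `ϖ^{2m} · (ϖ^b z) = ϖ^{b+2m} z`. -/
theorem zpow_two_mul_mul_pow_mul (m b : ℕ) (z : E) :
    algebraMap R E ϖ ^ (2 * (m : ℤ)) * (algebraMap R E ϖ ^ b * z) = algebraMap R E ϖ ^ (b + 2 * m) * z := by
  have : (2 * (m : ℤ)) = ((2 * m : ℕ) : ℤ) := by push_cast; ring
  rw [this, zpow_natCast, pow_add]
  ring

omit [StarRing E] in
include hϖ in
/-- The inverse conjugation: `ϖ^{−m} · (ϖ^{a+m} x) = ϖ^a x`. -/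
theorem zpow_neg_mul_pow_add_mul (m a : ℕ) (x : E) :
    algebraMap R E ϖ ^ (-(m : ℤ)) * (algebraMap R E ϖ ^ (a + m) * x) = algebraMap R E ϖ ^ a * x := by
  have hϖ0 : algebraMap R E ϖ ≠ 0 := (map_ne_zero_iff _ (IsFractionRing.injective R E)).2 hϖ.ne_zero
  rw [_root_.zpow_neg, zpow_natCast, pow_add]
  field_simp

omit [StarRing E] in
include hϖ in
/-- The inverse conjugation, second coordinate: `ϖ^{−2m} · (ϖ^{b+2m} z) = ϖ^b z`. -/
theorem zpow_neg_two_mul_mul_pow_add_mul (m b : ℕ) (z : E) :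
    algebraMap R E ϖ ^ (2 * -(m : ℤ)) * (algebraMap R E ϖ ^ (b + 2 * m) * z) = algebraMap R E ϖ ^ b * z := by
  have hϖ0 : algebraMap R E ϖ ≠ 0 := (map_ne_zero_iff _ (IsFractionRing.injective R E)).2 hϖ.ne_zero
  have : (2 * -(m : ℤ)) = -((2 * m : ℕ) : ℤ) := by push_cast; ring
  rw [this, _root_.zpow_neg, zpow_natCast, pow_add]
  field_simp

/-- **`a_m N_{a,b} a_m⁻¹ = N_{a+m, b+2m}`** (`m ∈ ℕ`). -/
theorem map_conj_cellU_unipCong (m a b : ℕ) (hab : b ≤ 2 * a) (hab' : b + 2 * m ≤ 2 * (a + m)) :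
    (unipCong hstar u hu' hs a b hab).map (MulAut.conj (cellU hϖ hs u m)).toMonoidHom =
      unipCong hstar u hu' hs (a + m) (b + 2 * m) hab' := by
  ext g
  rw [Subgroup.mem_map_equiv, mem_unipCong_iff, mem_unipCong_iff]
  simp only [MulAut.conj_symm_apply, Subgroup.coe_mul, Subgroup.coe_inv]
  constructor
  · rintro ⟨x, z, hg⟩
    refine ⟨x, z, ?_⟩
    have h1 : ((cellU hϖ hs u m : formUnitaryGroup (J3 u)) : GL (Fin 3) E) *
        (((cellU hϖ hs u m : formUnitaryGroup (J3 u)) : GL (Fin 3) E)⁻¹ * (g : GL (Fin 3) E) *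
          ((cellU hϖ hs u m : formUnitaryGroup (J3 u)) : GL (Fin 3) E)) *
        (((cellU hϖ hs u m : formUnitaryGroup (J3 u)) : GL (Fin 3) E))⁻¹ = (g : GL (Fin 3) E) := by
      group
    rw [← h1, hg, ← cellZ_natCast u hϖ hs m, cellZ_mul_upper3_mul_cellZ_inv, zpow_mul_pow_mul,
      zpow_two_mul_mul_pow_mul]
  · rintro ⟨x, z, hg⟩
    refine ⟨x, z, ?_⟩
    have h1 : (((cellU hϖ hs u m : formUnitaryGroup (J3 u)) : GL (Fin 3) E))⁻¹ * (g : GL (Fin 3) E) *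
        ((cellU hϖ hs u m : formUnitaryGroup (J3 u)) : GL (Fin 3) E) =
        ((cellZ u hϖ hs (-(m : ℤ)) : formUnitaryGroup (J3 u)) : GL (Fin 3) E) * (g : GL (Fin 3) E) *
          (((cellZ u hϖ hs (-(m : ℤ)) : formUnitaryGroup (J3 u)) : GL (Fin 3) E))⁻¹ := by
      rw [cellZ_neg, cellZ_natCast, Subgroup.coe_inv, inv_inv]
    rw [h1, hg, cellZ_mul_upper3_mul_cellZ_inv, zpow_neg_mul_pow_add_mul hϖ, zpow_neg_two_mul_mul_pow_add_mul hϖ]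

end ConjCong

end Summit.Ventures.HodgeRepro2.T5InertUnipotentRadical
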